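import Mathlib
import Summits.Ventures.HodgeRepro2.T5UnramifiedCharacter
import Summits.Ventures.HodgeRepro2.T5LocalFieldUnitsDecomposition
import Summits.Ventures.HodgeRepro2.T5AdicCompletionRamified

/-!
# Unramified characters at a RAMIFIED quadratic place: the restriction to the base

`T5UnramifiedCharacter` (row E9 of `route/TIER5.md` §N4.1) shows that at an INERT place an
unramified character of `E_v^×` trivial on `F_v^×` is trivial. At a RAMIFIED place this fails:
`π_F = u ϖ_E²`, so an unramified `χ` has `χ(π_F) = χ(ϖ_E)²`, and `χ` is trivial on
`F_v^× = U_F · π_F^ℤ` exactly when `χ(ϖ_E)² = 1` — there are two such characters, the trivial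
one and the unramified quadratic character `μ` (`μ(ϖ_E) = −1`). This is the sentence of Lemma
N5.L4(ii) of §N5.11.4: «at a RAMIFIED `v`, `ξμ` is again conjugate-symplectic (`μ` is
conjugate-orthogonal)», i.e. `μ|_{F_v^×} = 1`. Kernel-checked here:

* abstractly (`eq_one_on_of_sq_eq_one`, `sq_eq_one_of_eq_one_on`): for discrete valuation rings
  `R → S` with `algebraMap π = u ϖ²`, `L = Frac(S)`, and a subgroup `F ≤ Lˣ` generated by the
  base units and the image of `π` («`F_v^× = U_F π_F^ℤ`»), an unramified character of `Lˣ`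
  (trivial on the units of `S`) is trivial on `F` iff `χ(ϖ_L)² = 1`;
* on Mathlib's completions (`eq_one_on_baseUnits_iff_sq_eq_one`): at a ramified quadratic place
  of `Kv ⊆ Lw` (`[Lw : Kv] = 2`, `ϖ_K` not a uniformiser of `O_{Lw}`), an unramified character
  of `Lwˣ` (in the `Valued.v u = 1 → χ u = 1` form of row E9) is trivial on the image of
  `Kvˣ` iff its value on the uniformiser of `Lw` squares to `1` — the complement of
  `T5UnramifiedCharacter.eq_one_of_unramified_of_trivial_on_base` (inert places).

Declaration per README §8(d): «uses an L-value-free non-vanishing device: NO».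
-/

namespace Summit.Ventures.HodgeRepro2.T5UnramifiedCharacterRamified

open T5PrincipalUnitComparison T5LocalFieldUnitsDecomposition IsDedekindDomain HeightOneSpectrum

section Abstract

variable {R S L : Type*} [CommRing R] [CommRing S] [Algebra R S] [Field L] [Algebra S L]
  [IsFractionRing S L] {M : Type*} [CommGroup M]
variable {ϖ : S} {u : Sˣ}

/-- The value of an unramified character on the image of `π` is `χ(ϖ_L)²`. -/
theorem apply_base_uniformizer (hϖ : Irreducible ϖ) (χ : Lˣ →* M)
    (hχ : ∀ s : Sˣ, χ (Units.map (algebraMap S L : S →* L) s) = 1) :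
    χ (Units.map (algebraMap S L : S →* L) u * (uniformizerUnit ϖ hϖ) ^ 2) =
      χ (uniformizerUnit ϖ hϖ) ^ 2 := by
  rw [map_mul, map_pow, hχ u, one_mul]

/-- An unramified character trivial on the image of `π = u ϖ²` has `χ(ϖ_L)² = 1`. -/
theorem sq_eq_one_of_eq_one_on (hϖ : Irreducible ϖ) (F : Subgroup Lˣ)
    (hF : Units.map (algebraMap S L : S →* L) u * (uniformizerUnit ϖ hϖ) ^ 2 ∈ F)
    (χ : Lˣ →* M) (hχ : ∀ s : Sˣ, χ (Units.map (algebraMap S L : S →* L) s) = 1)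
    (h : ∀ f ∈ F, χ f = 1) : χ (uniformizerUnit ϖ hϖ) ^ 2 = 1 := by
  rw [← apply_base_uniformizer hϖ χ hχ]
  exact h _ hF

/-- An unramified character with `χ(ϖ_L)² = 1` is trivial on every subgroup `F` of `Lˣ`
generated by the base units `image(Rˣ)` and the image of `π` («`F_v^× = U_F · π_F^ℤ`»). -/
theorem eq_one_on_of_sq_eq_one (hϖ : Irreducible ϖ) (F : Subgroup Lˣ)
    (hF : ∀ x ∈ F, ∃ (r : Rˣ) (k : ℤ), x = Units.map (algebraMap S L : S →* L) (unitsMap r) *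
      (Units.map (algebraMap S L : S →* L) u * (uniformizerUnit ϖ hϖ) ^ 2) ^ k)
    (χ : Lˣ →* M) (hχ : ∀ s : Sˣ, χ (Units.map (algebraMap S L : S →* L) s) = 1)
    (h : χ (uniformizerUnit ϖ hϖ) ^ 2 = 1) : ∀ f ∈ F, χ f = 1 := by
  intro f hf
  obtain ⟨r, k, rfl⟩ := hF f hf
  rw [map_mul, hχ, map_zpow, apply_base_uniformizer hϖ χ hχ, h, one_zpow, one_mul]

/-- The two-sided form: for `F` as in `eq_one_on_of_sq_eq_one` containing the image of `π`,
an unramified character is trivial on `F` iff `χ(ϖ_L)² = 1`. -/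
theorem eq_one_on_iff_sq_eq_one (hϖ : Irreducible ϖ) (F : Subgroup Lˣ)
    (hFmem : Units.map (algebraMap S L : S →* L) u * (uniformizerUnit ϖ hϖ) ^ 2 ∈ F)
    (hF : ∀ x ∈ F, ∃ (r : Rˣ) (k : ℤ), x = Units.map (algebraMap S L : S →* L) (unitsMap r) *
      (Units.map (algebraMap S L : S →* L) u * (uniformizerUnit ϖ hϖ) ^ 2) ^ k)
    (χ : Lˣ →* M) (hχ : ∀ s : Sˣ, χ (Units.map (algebraMap S L : S →* L) s) = 1) :
    (∀ f ∈ F, χ f = 1) ↔ χ (uniformizerUnit ϖ hϖ) ^ 2 = 1 :=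
  ⟨sq_eq_one_of_eq_one_on hϖ F hFmem χ hχ, eq_one_on_of_sq_eq_one hϖ F hF χ hχ⟩

end Abstract

section Concrete

variable {K : Type*} [Field K] [NumberField K] (v : HeightOneSpectrum (NumberField.RingOfIntegers K))
variable {L : Type*} [Field L] [NumberField L] [Algebra K L]
  (w : HeightOneSpectrum (NumberField.RingOfIntegers L))
variable [Algebra (adicCompletion K v) (adicCompletion L w)]
  [ContinuousSMul (adicCompletion K v) (adicCompletion L w)]
  [IsScalarTower K (adicCompletion K v) (adicCompletion L w)]
variable {M : Type*} [CommGroup M]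


/-- The units of `O_{Lw}` have valuation `1` in `Lw`. -/
theorem val_algebraMap_units (s : (adicCompletionIntegers L w)ˣ) :
    Valued.v ((Units.map (algebraMap (adicCompletionIntegers L w) (adicCompletion L w) : (adicCompletionIntegers L w) →* adicCompletion L w) s :
      (adicCompletion L w)ˣ) : adicCompletion L w) = 1 :=
  (adicCompletionIntegers.integers L w).one_of_isUnit s.isUnit

omit [Algebra K L] [IsScalarTower K (adicCompletion K v) (adicCompletion L w)] in
/-- The base-change map `Kvˣ → Lwˣ` on the units of `O_{Kv}` is the map on integral units. -/
theorem baseUnits_map_units (s : (adicCompletionIntegers K v)ˣ) :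
    T5UnramifiedCharacter.baseUnits v w
        (Units.map (algebraMap (adicCompletionIntegers K v) (adicCompletion K v) : (adicCompletionIntegers K v) →* adicCompletion K v) s) =
      Units.map (algebraMap (adicCompletionIntegers L w) (adicCompletion L w) : (adicCompletionIntegers L w) →* adicCompletion L w) (unitsMap s) := by
  apply Units.ext
  show algebraMap (adicCompletion K v) (adicCompletion L w) (algebraMap (adicCompletionIntegers K v) (adicCompletion K v) s) =
    algebraMap (adicCompletionIntegers L w) (adicCompletion L w) (algebraMap (adicCompletionIntegers K v) (adicCompletionIntegers L w) s)
  rw [← IsScalarTower.algebraMap_apply, ← IsScalarTower.algebraMap_apply]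

omit [Algebra K L] [IsScalarTower K (adicCompletion K v) (adicCompletion L w)] in
/-- The base-change map sends the uniformiser of `Kv` to `u · π_{Lw}²` when
`algebraMap ϖ = u π²` in `O_{Lw}`. -/
theorem baseUnits_uniformizerUnit {ϖ : (adicCompletionIntegers K v)} (hϖ : Irreducible ϖ) {π : (adicCompletionIntegers L w)} (hπ : Irreducible π)
    {u : (adicCompletionIntegers L w)ˣ} (hu : algebraMap (adicCompletionIntegers K v) (adicCompletionIntegers L w) ϖ = u * π ^ 2) :
    T5UnramifiedCharacter.baseUnits v w (uniformizerUnit ϖ hϖ) =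
      Units.map (algebraMap (adicCompletionIntegers L w) (adicCompletion L w) : (adicCompletionIntegers L w) →* adicCompletion L w) u *
        (uniformizerUnit π hπ) ^ 2 := by
  apply Units.ext
  show algebraMap (adicCompletion K v) (adicCompletion L w) (algebraMap (adicCompletionIntegers K v) (adicCompletion K v) ϖ) =
    algebraMap (adicCompletionIntegers L w) (adicCompletion L w) u * (algebraMap (adicCompletionIntegers L w) (adicCompletion L w) π) ^ 2
  rw [← IsScalarTower.algebraMap_apply, IsScalarTower.algebraMap_apply (adicCompletionIntegers K v) (adicCompletionIntegers L w) (adicCompletion L w),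
    hu, map_mul, map_pow]

/-- At a RAMIFIED quadratic place an unramified character of `Lwˣ` (`Valued.v x = 1 → χ x = 1`)
is trivial on the image of `Kvˣ` iff its value on a uniformiser of `Lw` squares to `1` — the
complement of `T5UnramifiedCharacter.eq_one_of_unramified_of_trivial_on_base` (the inert case,
where only the trivial character qualifies); Lemma N5.L4(ii)'s «`μ` is conjugate-orthogonal at a
ramified `v`» is the direction `←` for `χ(ϖ_E) = −1`. -/
theorem eq_one_on_baseUnits_iff_sq_eq_one
    (hfin : Module.finrank (adicCompletion K v) (adicCompletion L w) = 2)
    {ϖ : (adicCompletionIntegers K v)} (hϖ : Irreducible ϖ) {π : (adicCompletionIntegers L w)} (hπ : Irreducible π)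
    (hram : ¬ Irreducible (algebraMap (adicCompletionIntegers K v) (adicCompletionIntegers L w) ϖ)) (χ : (adicCompletion L w)ˣ →* M)
    (hχ : ∀ x : (adicCompletion L w)ˣ, Valued.v (x : adicCompletion L w) = 1 → χ x = 1) :
    (∀ y : (adicCompletion K v)ˣ, χ (T5UnramifiedCharacter.baseUnits v w y) = 1) ↔
      χ (uniformizerUnit π hπ) ^ 2 = 1 := by
  obtain ⟨u, hu⟩ := T5AdicCompletionRamified.exists_unit_algebraMap_eq_mul_sq v w hfin hϖ hπ hram
  have hχ' : ∀ s : (adicCompletionIntegers L w)ˣ,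
      χ (Units.map (algebraMap (adicCompletionIntegers L w) (adicCompletion L w) : (adicCompletionIntegers L w) →* adicCompletion L w) s) = 1 :=
    fun s => hχ _ (val_algebraMap_units w s)
  constructor
  · intro h
    have h1 := h (uniformizerUnit ϖ hϖ)
    rw [baseUnits_uniformizerUnit v w hϖ hπ hu, map_mul, map_pow, hχ' u, one_mul] at h1
    exact h1
  · intro h y
    obtain ⟨s, k, hsk⟩ := exists_unit_mul_zpow (S := (adicCompletionIntegers K v)) (L := adicCompletion K v) ϖ hϖ
      (y : adicCompletion K v) y.ne_zero
    have hy : y = Units.map (algebraMap (adicCompletionIntegers K v) (adicCompletion K v) : (adicCompletionIntegers K v) →* adicCompletion K v) s *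
        (uniformizerUnit ϖ hϖ) ^ k := by
      apply Units.ext
      rw [hsk, Units.val_mul, Units.val_zpow_eq_zpow_val]
      rfl
    rw [hy, map_mul, map_mul, map_zpow, map_zpow, baseUnits_map_units, hχ',
      baseUnits_uniformizerUnit v w hϖ hπ hu, map_mul, map_pow, hχ' u, one_mul, one_mul, h,
      one_zpow]

end Concrete

end Summit.Ventures.HodgeRepro2.T5UnramifiedCharacterRamified
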